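import Literature.NumberTheory.Automorphic.ArchRankinSelbergPairBridge
import Literature.NumberTheory.Automorphic.ClosedCompactDecomposition
import Literature.MeasureTheory.Group.CosetAveragingLIntegral
import HarnessLib

/-!
# The unit-box pair integral of an integrand of product form: the finite factor averages out

Topic `NumberTheory/Automorphic`; namespace `Literature.NumberTheory.Automorphic`. Theorems only.

Let `I` be a function on the torus-compact coordinates `(a, k) ∈ (𝔸_Kˣ)ⁿ × K` which ON THE UNIT BOX
`a ∈ 𝕌_Kⁿ` (all finite coordinates units) is of PRODUCT FORM

  `I(a, k) = F((diag(a) k)_f) · Γ(a_∞, k_∞)`,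

with `F` a function on `GL_n(𝔸_K^∞)` right invariant (on `GL_n(𝒪̂_K)`) under an open subgroup `U`
normalised by `GL_n(𝒪̂_K)` (e.g. a principal congruence subgroup), and `Γ` a continuous function of the
archimedean coordinates, integrable over the box. Then (`setIntegral_unitBox_univ_eq_avg_mul_integral_map`)

  `∫_{𝕌_Kⁿ × K} I d(νA × νK) = c_F · ∫ Γ d((νA|_{𝕌ⁿ}.map Θ) × (νK.map π))`,
  `c_F = (#Q)⁻¹ ∑_{q ∈ Q} F(r_q)`,  `Q = GL_n(𝒪̂_K) / (U ∩ GL_n(𝒪̂_K))`,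

for the Haar measure `νK` of the (compact, hence unimodular) group `K` and any s-finite `νA`:
`(diag(a) k)_f ∈ GL_n(𝒪̂_K)` on the box, its class in the finite group `Q` is a measurable label,
right translation of `k` by `(1, r_q)` multiplies the label by `q`, preserves `νA × νK`
(`isMulRightInvariant_of_compactSpace`) and does not move the archimedean coordinates, so the abstract
averaging lemma `Literature.MeasureTheory.Group.setIntegral_mul_eq_avg_mul_setIntegral`
(`CosetAveraging`) applies, and the remaining integral of `Γ` is the archimedean one
(`setIntegral_unitBox_univ_prod_eq_integral_map_of_continuous`, `ArchRankinSelbergPairBridge`). This is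
how a locally constant finite-adelic Whittaker factor `|W_f|²` and the finite part of a test function
leave the unit-box part of an unfolded global Rankin–Selberg integral as a CONSTANT times an
archimedean local integral (Cogdell (2004), §4.1: `I(s; φ, φ', Φ) = ∏_v Ψ_v` for factorizable data).

## References

* J. W. Cogdell, *Analytic theory of L-functions for GL_n* (2004), §2.3, §4.1 [CogdellAnalyticTheory2004].
-/

noncomputable section

open MeasureTheory Measure NumberField NumberField.mixedEmbedding IsDedekindDomain Set Filter
open Literature.NumberTheory.GaloisRepresentations (ideleGroup unitIdeles mem_unitIdeles_iff)
open scoped MatrixGroups ENNReal NNReal Classical ComplexConjugate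

namespace Literature.NumberTheory.Automorphic

section Averaging

variable {n : ℕ} {K : Type} [Field K] [NumberField K]

attribute [local instance] adelicBorel borelSpace_adelic locallyCompactSpace_adelic secondCountableTopology_gl_adelic
  glAdeleBorel borelSpace_glAdele

attribute [local instance] Literature.MeasureTheory.Group.hasSummableGeomSeries_of_finiteDimensional
  Literature.MeasureTheory.Group.Units.borelSpace_of_isOpenEmbedding
  Literature.MeasureTheory.Group.Units.secondCountableTopology
  Literature.MeasureTheory.Group.Units.locallyCompactSpace

attribute [local instance] secondCountableTopology_ideleGroup borelSpace_pi_mixedUnits measurableMul_pi_mixedUnits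

/-- `(1, g) ∈ K` for `g ∈ GL_n(𝒪̂_K)`. [folklore] -/
theorem ofFinite_mem_maximalCompactAdelic {g : GL (Fin n) (FiniteAdeleRing (𝓞 K) K)}
    (hg : g ∈ glFiniteIntegralLevel n K) :
    (GLn.ofFinite n K g : (AdelicGroupData.gl n K).Adelic) ∈ maximalCompactAdelic n K :=
  glIntegralLevel_le_standardMaximalCompactGL (GLn.ofFinite_mem_glIntegralLevel hg)

/-- Right translation of the compact coordinate by `(1, g)` multiplies the finite part of the torus
point by `g` and fixes its archimedean part. [folklore] -/
theorem torusPoint_mul_ofFinite (p : (Fin n → ideleGroup K) × ↥(maximalCompactAdelic n K))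
    {g : GL (Fin n) (FiniteAdeleRing (𝓞 K) K)} (hg : g ∈ glFiniteIntegralLevel n K) :
    torusPoint n K (p.1, p.2 * ⟨GLn.ofFinite n K g, ofFinite_mem_maximalCompactAdelic hg⟩) =
      torusPoint n K p * GLn.ofFinite n K g := by
  simp only [torusPoint, Subgroup.coe_mul]
  rw [mul_assoc]
  rfl

variable [MeasurableSpace (ideleGroup K)] [BorelSpace (ideleGroup K)]
  [MeasurableSpace (GL (Fin n) (mixedSpace K))] [BorelSpace (GL (Fin n) (mixedSpace K))]

omit [MeasurableSpace (GL (Fin n) (mixedSpace K))] [BorelSpace (GL (Fin n) (mixedSpace K))] in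
/-- **The coset datum of the unit box.** For an open subgroup `U` normalised by `GL_n(𝒪̂_K)` there are:
the finite group `Q = GL_n(𝒪̂_K) / (U ∩ GL_n(𝒪̂_K))` with representatives `r q ∈ GL_n(𝒪̂_K)`, `r 1 ∈ U`,
a label `c` on `(𝔸_Kˣ)ⁿ × K` with measurable fibres which on the unit box is the class of `(diag(a) k)_f`
(so that every right `U`-invariant `F` satisfies `F((diag(a) k)_f) = F(r (c (a, k)))` there), and lifts
`ρ q = (1, r q) ∈ K` of the representatives, right translation by which multiplies the label by `q` and
does not move the archimedean coordinate. [folklore] -/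
theorem exists_unitBox_cosetDatum (hcpt : isCompact_glFiniteIntegralLevel n K)
    {U : Subgroup (GL (Fin n) (FiniteAdeleRing (𝓞 K) K))}
    (hUo : IsOpen (U : Set (GL (Fin n) (FiniteAdeleRing (𝓞 K) K))))
    (hUn : ∀ g ∈ glFiniteIntegralLevel n K, ∀ u ∈ U, g * u * g⁻¹ ∈ U) :
    ∃ (Q : Type) (_ : Group Q) (_ : Fintype Q) (_ : DecidableEq Q)
      (r : Q → GL (Fin n) (FiniteAdeleRing (𝓞 K) K))
      (c : (Fin n → ideleGroup K) × ↥(maximalCompactAdelic n K) → Q)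
      (ρ : Q → ↥(maximalCompactAdelic n K)),
      r 1 ∈ U ∧ (∀ q, r q ∈ glFiniteIntegralLevel n K) ∧
      (∀ q, MeasurableSet (c ⁻¹' {q})) ∧
      (∀ (p : (Fin n → ideleGroup K) × ↥(maximalCompactAdelic n K)) (q : Q), c (p.1, p.2 * ρ q) = c p * q) ∧
      (∀ (k : ↥(maximalCompactAdelic n K)) (q : Q),
        kinfOfMaximalCompact n K (k * ρ q) = kinfOfMaximalCompact n K k) ∧
      ∀ (X : Type) (F : GL (Fin n) (FiniteAdeleRing (𝓞 K) K) → X),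
        (∀ g ∈ glFiniteIntegralLevel n K, ∀ u ∈ U, F (g * u) = F g) →
        ∀ p : (Fin n → ideleGroup K) × ↥(maximalCompactAdelic n K),
          p.1 ∈ unitBox (n := n) (K := K) (Set.univ : Set (HeightOneSpectrum (𝓞 K))) →
            F (GLn.sndHom n K (torusPoint n K p)) = F (r (c p)) := by
  classical
  have hmul_snd : ∀ k k' : ↥(maximalCompactAdelic n K),
      GLn.sndHom n K ((k * k' : ↥(maximalCompactAdelic n K)) : (AdelicGroupData.gl n K).Adelic) =
        GLn.sndHom n K (k : (AdelicGroupData.gl n K).Adelic) * GLn.sndHom n K (k' : (AdelicGroupData.gl n K).Adelic) :=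
    fun k k' => map_mul (GLn.sndHom n K) _ _
  have hmul_mixed : ∀ k k' : ↥(maximalCompactAdelic n K),
      GLn.toMixed n K ((k * k' : ↥(maximalCompactAdelic n K)) : (AdelicGroupData.gl n K).Adelic) =
        GLn.toMixed n K (k : (AdelicGroupData.gl n K).Adelic) * GLn.toMixed n K (k' : (AdelicGroupData.gl n K).Adelic) :=
    fun k k' => map_mul (GLn.toMixed n K) _ _
  -- the finite group `Q = GL_n(𝒪̂) / U`
  set Kf : Subgroup (GL (Fin n) (FiniteAdeleRing (𝓞 K) K)) := glFiniteIntegralLevel n K with hKf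
  haveI : CompactSpace ↥Kf := isCompact_iff_compactSpace.1 hcpt
  set H : Subgroup ↥Kf := U.subgroupOf Kf with hH
  haveI hHn : H.Normal := by
    refine ⟨fun u hu g => ?_⟩
    change ((g * u * g⁻¹ : ↥Kf) : GL (Fin n) (FiniteAdeleRing (𝓞 K) K)) ∈ U
    simp only [Subgroup.coe_mul, Subgroup.coe_inv]
    exact hUn g.1 g.2 u.1 hu
  have hHo : IsOpen (H : Set ↥Kf) := hUo.preimage continuous_subtype_val
  haveI : Finite (↥Kf ⧸ H) := Subgroup.quotient_finite_of_isOpen H hHo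
  haveI : Fintype (↥Kf ⧸ H) := Fintype.ofFinite _
  set Q := ↥Kf ⧸ H with hQ
  -- representatives and their lifts to `K`
  set rep : Q → GL (Fin n) (FiniteAdeleRing (𝓞 K) K) := fun q => ((Quotient.out q : ↥Kf) : GL (Fin n) (FiniteAdeleRing (𝓞 K) K))
    with hrep
  have hrep_mem : ∀ q, rep q ∈ glFiniteIntegralLevel n K := fun q => (Quotient.out q).2
  have hrep_mk : ∀ q : Q, (QuotientGroup.mk (Quotient.out q) : Q) = q := fun q => Quotient.out_eq q
  set ρ : Q → ↥(maximalCompactAdelic n K) := fun q =>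
    ⟨GLn.ofFinite n K (rep q), ofFinite_mem_maximalCompactAdelic (hrep_mem q)⟩ with hρ
  -- the class map (on the box: the class of `(diag(a) k)_f`; off the box: the class of `k_f`)
  set box : Set (Fin n → ideleGroup K) := unitBox (Set.univ : Set (HeightOneSpectrum (𝓞 K))) with hbox
  set c : (Fin n → ideleGroup K) × ↥(maximalCompactAdelic n K) → Q := fun p =>
    if h : p.1 ∈ box then QuotientGroup.mk ⟨GLn.sndHom n K (torusPoint n K p), sndHom_torusPoint_mem_glFiniteIntegralLevel h p.2⟩
    else QuotientGroup.mk ⟨GLn.sndHom n K (p.2 : (AdelicGroupData.gl n K).Adelic), sndHom_mem_of_mem_standardMaximalCompactGL p.2.2⟩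
    with hc
  -- equivariance of the class map under right translation by the representatives
  have hsnd : ∀ (p : (Fin n → ideleGroup K) × ↥(maximalCompactAdelic n K)) (q : Q),
      GLn.sndHom n K (torusPoint n K (p.1, p.2 * ρ q)) = GLn.sndHom n K (torusPoint n K p) * rep q := fun p q => by
    rw [hρ]
    dsimp only
    rw [torusPoint_mul_ofFinite p (hrep_mem q), map_mul, GLn.sndHom_ofFinite]
  have hsnd' : ∀ (p : (Fin n → ideleGroup K) × ↥(maximalCompactAdelic n K)) (q : Q),
      GLn.sndHom n K ((p.2 * ρ q : ↥(maximalCompactAdelic n K)) : (AdelicGroupData.gl n K).Adelic) =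
        GLn.sndHom n K (p.2 : (AdelicGroupData.gl n K).Adelic) * rep q := fun p q => by
    rw [hmul_snd, hρ]
    dsimp only
    rw [GLn.sndHom_ofFinite]
  have hcρ : ∀ (p : (Fin n → ideleGroup K) × ↥(maximalCompactAdelic n K)) (q : Q), c (p.1, p.2 * ρ q) = c p * q := by
    intro p q
    rw [hc]
    dsimp only
    by_cases hp : p.1 ∈ box
    · rw [dif_pos hp, dif_pos hp, ← hrep_mk q, ← QuotientGroup.mk_mul, hrep_mk q]
      congr 1
      exact Subtype.ext (by simp only [Subgroup.coe_mul]; exact hsnd p q)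
    · rw [dif_neg hp, dif_neg hp, ← hrep_mk q, ← QuotientGroup.mk_mul, hrep_mk q]
      congr 1
      exact Subtype.ext (by simp only [Subgroup.coe_mul]; exact hsnd' p q)
  -- measurability of the fibres of the class map
  have hKfo : IsOpen (Kf : Set (GL (Fin n) (FiniteAdeleRing (𝓞 K) K))) := isOpen_glFiniteIntegralLevel n K
  have hfib : ∀ q : Q, IsOpen ((QuotientGroup.mk : ↥Kf → Q) ⁻¹' {q}) := by
    intro q
    have hset : (QuotientGroup.mk : ↥Kf → Q) ⁻¹' {q} = (fun x : ↥Kf => x⁻¹ * Quotient.out q) ⁻¹' (H : Set ↥Kf) := by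
      ext x
      simp only [Set.mem_preimage, Set.mem_singleton_iff, SetLike.mem_coe]
      constructor
      · intro hx
        have h2 : (QuotientGroup.mk x : Q) = QuotientGroup.mk (Quotient.out q) := by rw [hx, hrep_mk]
        exact QuotientGroup.eq.1 h2
      · intro hx
        rw [QuotientGroup.eq.2 hx, hrep_mk]
    rw [hset]
    exact hHo.preimage (continuous_id.inv.mul continuous_const)
  have hcmeas : ∀ q : Q, MeasurableSet (c ⁻¹' {q}) := by
    intro q
    set C : Set (GL (Fin n) (FiniteAdeleRing (𝓞 K) K)) := Subtype.val '' ((QuotientGroup.mk : ↥Kf → Q) ⁻¹' {q}) with hC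
    have hCo : IsOpen C := hKfo.isOpenMap_subtype_val _ (hfib q)
    have hmem : ∀ (g : GL (Fin n) (FiniteAdeleRing (𝓞 K) K)) (hg : g ∈ Kf),
        (QuotientGroup.mk (⟨g, hg⟩ : ↥Kf) : Q) = q ↔ g ∈ C := by
      intro g hg
      constructor
      · intro h
        exact ⟨⟨g, hg⟩, h, rfl⟩
      · rintro ⟨g', hg', hgg'⟩
        have : g' = ⟨g, hg⟩ := Subtype.ext hgg'
        rw [← this]
        exact hg'
    have hset : c ⁻¹' {q} =
        ((box ×ˢ (Set.univ : Set ↥(maximalCompactAdelic n K))) ∩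
          (fun p : (Fin n → ideleGroup K) × ↥(maximalCompactAdelic n K) => GLn.sndHom n K (torusPoint n K p)) ⁻¹' C) ∪
        ((box ×ˢ (Set.univ : Set ↥(maximalCompactAdelic n K)))ᶜ ∩
          (fun p : (Fin n → ideleGroup K) × ↥(maximalCompactAdelic n K) =>
            GLn.sndHom n K (p.2 : (AdelicGroupData.gl n K).Adelic)) ⁻¹' C) := by
      ext p
      simp only [Set.mem_preimage, Set.mem_singleton_iff, Set.mem_union, Set.mem_inter_iff, Set.mem_prod,
        Set.mem_univ, and_true, Set.mem_compl_iff]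
      rw [hc]
      dsimp only
      by_cases hp : p.1 ∈ box
      · rw [dif_pos hp, hmem]
        tauto
      · rw [dif_neg hp, hmem]
        tauto
    rw [hset]
    have hboxm : MeasurableSet (box ×ˢ (Set.univ : Set ↥(maximalCompactAdelic n K))) :=
      (measurableSet_unitBox _).prod MeasurableSet.univ
    have h1 : Continuous fun p : (Fin n → ideleGroup K) × ↥(maximalCompactAdelic n K) =>
        GLn.sndHom n K (torusPoint n K p) := (GLn.continuous_sndHom (n := n) (K := K)).comp continuous_torusPoint
    have h2 : Continuous fun p : (Fin n → ideleGroup K) × ↥(maximalCompactAdelic n K) =>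
        GLn.sndHom n K (p.2 : (AdelicGroupData.gl n K).Adelic) :=
      (GLn.continuous_sndHom (n := n) (K := K)).comp (continuous_subtype_val.comp continuous_snd)
    exact (hboxm.inter (hCo.preimage h1).measurableSet).union (hboxm.compl.inter (hCo.preimage h2).measurableSet)
  -- the archimedean coordinate does not move
  have hkinf : ∀ (k : ↥(maximalCompactAdelic n K)) (q : Q),
      kinfOfMaximalCompact n K (k * ρ q) = kinfOfMaximalCompact n K k := fun k q => by
    apply Subtype.ext
    change GLn.toMixed n K ((k * ρ q : ↥(maximalCompactAdelic n K)) : (AdelicGroupData.gl n K).Adelic) =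
      GLn.toMixed n K (k : (AdelicGroupData.gl n K).Adelic)
    rw [hmul_mixed, hρ]
    dsimp only
    rw [GLn.toMixed_ofFinite, mul_one]
  -- on the box a right `U`-invariant `F` is a function of the class
  have hFc : ∀ (X : Type) (F : GL (Fin n) (FiniteAdeleRing (𝓞 K) K) → X),
      (∀ g ∈ glFiniteIntegralLevel n K, ∀ u ∈ U, F (g * u) = F g) →
      ∀ p : (Fin n → ideleGroup K) × ↥(maximalCompactAdelic n K), p.1 ∈ box →
        F (GLn.sndHom n K (torusPoint n K p)) = F (rep (c p)) := by
    intro X F hF p hp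
    rw [hc]
    dsimp only
    rw [dif_pos hp]
    set g : ↥Kf := ⟨GLn.sndHom n K (torusPoint n K p), sndHom_torusPoint_mem_glFiniteIntegralLevel hp p.2⟩ with hg
    have hr : (QuotientGroup.mk (Quotient.out (QuotientGroup.mk g : Q)) : Q) = QuotientGroup.mk g := hrep_mk _
    rw [QuotientGroup.eq] at hr
    -- `(out)⁻¹ * g ∈ H`, i.e. `g = out * u` with `u ∈ U`
    have hu : ((Quotient.out (QuotientGroup.mk g : Q) : ↥Kf) : GL (Fin n) (FiniteAdeleRing (𝓞 K) K))⁻¹ *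
        GLn.sndHom n K (torusPoint n K p) ∈ U := hr
    have heq : GLn.sndHom n K (torusPoint n K p) =
        ((Quotient.out (QuotientGroup.mk g : Q) : ↥Kf) : GL (Fin n) (FiniteAdeleRing (𝓞 K) K)) *
          (((Quotient.out (QuotientGroup.mk g : Q) : ↥Kf) : GL (Fin n) (FiniteAdeleRing (𝓞 K) K))⁻¹ *
            GLn.sndHom n K (torusPoint n K p)) := by rw [mul_inv_cancel_left]
    conv_lhs => rw [heq]
    exact hF _ (hrep_mem _) _ hu
  have h1 : rep 1 ∈ U := by
    have h := hrep_mk 1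
    rw [QuotientGroup.eq_one_iff] at h
    exact h
  exact ⟨Q, inferInstance, inferInstance, inferInstance, rep, c, ρ, h1, hrep_mem, hcmeas, hcρ, hkinf, hFc⟩

/-- **The unit-box integral of a product-form integrand: the finite factor averages out.** See the
module docstring. The finitely many coset representatives `r q ∈ GL_n(𝒪̂_K)` (`r q₀ ∈ U`) through which
the constant `c_F = (#Q)⁻¹ ∑_q F(r q)` is expressed are chosen ONCE, independently of the archimedean
factor `Γ` and of `F`. [cite: CogdellAnalyticTheory2004, §4.1] -/
theorem setIntegral_unitBox_univ_eq_avg_mul_integral_map (hcpt : isCompact_glFiniteIntegralLevel n K)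
    (νA : Measure (Fin n → ideleGroup K)) [SFinite νA]
    (νK : Measure ↥(maximalCompactAdelic n K)) [IsHaarMeasure νK]
    {U : Subgroup (GL (Fin n) (FiniteAdeleRing (𝓞 K) K))}
    (hUo : IsOpen (U : Set (GL (Fin n) (FiniteAdeleRing (𝓞 K) K))))
    (hUn : ∀ g ∈ glFiniteIntegralLevel n K, ∀ u ∈ U, g * u * g⁻¹ ∈ U) :
    ∃ (Q : Type) (_ : Fintype Q) (r : Q → GL (Fin n) (FiniteAdeleRing (𝓞 K) K)) (q₀ : Q),
      r q₀ ∈ U ∧ (∀ q, r q ∈ glFiniteIntegralLevel n K) ∧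
      ∀ (F : GL (Fin n) (FiniteAdeleRing (𝓞 K) K) → ℂ),
        (∀ g ∈ glFiniteIntegralLevel n K, ∀ u ∈ U, F (g * u) = F g) →
      ∀ {Γ : (Fin n → (mixedSpace K)ˣ) × ↥(Kinf n K) → ℂ}, Continuous Γ →
        IntegrableOn (fun p : (Fin n → ideleGroup K) × ↥(maximalCompactAdelic n K) =>
          Γ (archTorusOfIdele n K p.1, kinfOfMaximalCompact n K p.2))
          (unitBox (Set.univ : Set (HeightOneSpectrum (𝓞 K))) ×ˢ Set.univ) (νA.prod νK) →
      ∀ (I : (Fin n → ideleGroup K) × ↥(maximalCompactAdelic n K) → ℂ),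
        (∀ p : (Fin n → ideleGroup K) × ↥(maximalCompactAdelic n K),
          p.1 ∈ unitBox (n := n) (K := K) (Set.univ : Set (HeightOneSpectrum (𝓞 K))) →
            I p = F (GLn.sndHom n K (torusPoint n K p)) * Γ (archTorusOfIdele n K p.1, kinfOfMaximalCompact n K p.2)) →
        ∫ p in unitBox (Set.univ : Set (HeightOneSpectrum (𝓞 K))) ×ˢ Set.univ, I p ∂(νA.prod νK) =
          ((Fintype.card Q : ℂ)⁻¹ * ∑ q, F (r q)) *
            ∫ z, Γ z ∂(((νA.restrict (unitBox (Set.univ : Set (HeightOneSpectrum (𝓞 K))))).map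
              (archTorusOfIdele n K)).prod (νK.map (kinfOfMaximalCompact n K))) := by
  classical
  haveI : CompactSpace ↥(maximalCompactAdelic n K) := isCompact_iff_compactSpace.1 (isCompact_maximalCompactAdelic n K)
  haveI := secondCountableTopology_gl_adelic n K
  haveI : SecondCountableTopology ↥(maximalCompactAdelic n K) :=
    TopologicalSpace.Subtype.secondCountableTopology ((maximalCompactAdelic n K : Set (AdelicGroupData.gl n K).Adelic))
  haveI : νK.IsMulRightInvariant := isMulRightInvariant_of_compactSpace νK
  obtain ⟨Q, _, _, _, r, c, ρ, h1, hr, hcmeas, hcρ, hkinf, hFc⟩ := exists_unitBox_cosetDatum hcpt hUo hUn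
  refine ⟨Q, inferInstance, r, 1, h1, hr, fun F hF Γ hΓ hint I hI => ?_⟩
  set box : Set (Fin n → ideleGroup K) := unitBox (Set.univ : Set (HeightOneSpectrum (𝓞 K))) with hbox
  set Fq : Q → ℂ := fun q => F (r q) with hFq
  set Γ' : (Fin n → ideleGroup K) × ↥(maximalCompactAdelic n K) → ℂ := fun p =>
    Γ (archTorusOfIdele n K p.1, kinfOfMaximalCompact n K p.2) with hΓ'
  have hΓρ : ∀ (p : (Fin n → ideleGroup K) × ↥(maximalCompactAdelic n K)) (q : Q), Γ' (p.1, p.2 * ρ q) = Γ' p :=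
    fun p q => by simp only [hΓ', hkinf]
  have hboxm : MeasurableSet (box ×ˢ (Set.univ : Set ↥(maximalCompactAdelic n K))) :=
    (measurableSet_unitBox _).prod MeasurableSet.univ
  have hIeq : ∀ p ∈ box ×ˢ (Set.univ : Set ↥(maximalCompactAdelic n K)), I p = Fq (c p) * Γ' p := by
    rintro p ⟨hp, -⟩
    rw [hI p hp, hFc ℂ F hF p hp]
  rw [setIntegral_congr_fun hboxm hIeq,
    Literature.MeasureTheory.Group.setIntegral_mul_eq_avg_mul_setIntegral νA νK hcmeas ρ hcρ
      (measurableSet_unitBox _) Fq Γ' hΓρ hint,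
    setIntegral_unitBox_univ_prod_eq_integral_map_of_continuous νA νK hΓ]

omit [MeasurableSpace (GL (Fin n) (mixedSpace K))] [BorelSpace (GL (Fin n) (mixedSpace K))] in
/-- **Integrability of the archimedean factor from integrability of the product.** In the situation of
`setIntegral_unitBox_univ_eq_avg_mul_integral_map`, if the product-form integrand `I` is integrable on the
unit box and `F 1 ≠ 0`, then so is the archimedean factor `(a, k) ↦ Γ(a_∞, k_∞)` (the average of `‖F‖`
over the cosets is positive; `Literature.MeasureTheory.Group.integrableOn_of_integrableOn_fiberConst_mul`).
[folklore] -/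
theorem integrableOn_unitBox_univ_of_productForm (hcpt : isCompact_glFiniteIntegralLevel n K)
    (νA : Measure (Fin n → ideleGroup K)) [SFinite νA]
    (νK : Measure ↥(maximalCompactAdelic n K)) [IsHaarMeasure νK]
    {U : Subgroup (GL (Fin n) (FiniteAdeleRing (𝓞 K) K))}
    (hUo : IsOpen (U : Set (GL (Fin n) (FiniteAdeleRing (𝓞 K) K))))
    (hUn : ∀ g ∈ glFiniteIntegralLevel n K, ∀ u ∈ U, g * u * g⁻¹ ∈ U)
    (F : GL (Fin n) (FiniteAdeleRing (𝓞 K) K) → ℂ)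
    (hF : ∀ g ∈ glFiniteIntegralLevel n K, ∀ u ∈ U, F (g * u) = F g) (hF1 : F 1 ≠ 0)
    {Γ : (Fin n → (mixedSpace K)ˣ) × ↥(Kinf n K) → ℂ} (hΓ : Continuous Γ)
    (I : (Fin n → ideleGroup K) × ↥(maximalCompactAdelic n K) → ℂ)
    (hI : ∀ p : (Fin n → ideleGroup K) × ↥(maximalCompactAdelic n K),
      p.1 ∈ unitBox (n := n) (K := K) (Set.univ : Set (HeightOneSpectrum (𝓞 K))) →
        I p = F (GLn.sndHom n K (torusPoint n K p)) * Γ (archTorusOfIdele n K p.1, kinfOfMaximalCompact n K p.2))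
    (hint : IntegrableOn I (unitBox (Set.univ : Set (HeightOneSpectrum (𝓞 K))) ×ˢ Set.univ) (νA.prod νK)) :
    IntegrableOn (fun p : (Fin n → ideleGroup K) × ↥(maximalCompactAdelic n K) =>
        Γ (archTorusOfIdele n K p.1, kinfOfMaximalCompact n K p.2))
      (unitBox (Set.univ : Set (HeightOneSpectrum (𝓞 K))) ×ˢ Set.univ) (νA.prod νK) := by
  classical
  haveI : CompactSpace ↥(maximalCompactAdelic n K) := isCompact_iff_compactSpace.1 (isCompact_maximalCompactAdelic n K)
  haveI := secondCountableTopology_gl_adelic n K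
  haveI : SecondCountableTopology ↥(maximalCompactAdelic n K) :=
    TopologicalSpace.Subtype.secondCountableTopology ((maximalCompactAdelic n K : Set (AdelicGroupData.gl n K).Adelic))
  haveI : νK.IsMulRightInvariant := isMulRightInvariant_of_compactSpace νK
  obtain ⟨Q, _, _, _, r, c, ρ, h1, hr, hcmeas, hcρ, hkinf, hFc⟩ := exists_unitBox_cosetDatum hcpt hUo hUn
  set box : Set (Fin n → ideleGroup K) := unitBox (Set.univ : Set (HeightOneSpectrum (𝓞 K))) with hbox
  set Fq : Q → ℂ := fun q => F (r q) with hFq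
  set Γ' : (Fin n → ideleGroup K) × ↥(maximalCompactAdelic n K) → ℂ := fun p =>
    Γ (archTorusOfIdele n K p.1, kinfOfMaximalCompact n K p.2) with hΓ'
  have hΓρ : ∀ (p : (Fin n → ideleGroup K) × ↥(maximalCompactAdelic n K)) (q : Q), Γ' (p.1, p.2 * ρ q) = Γ' p :=
    fun p q => by simp only [hΓ', hkinf]
  have hΓ'c : Continuous Γ' :=
    hΓ.comp ((continuous_archTorusOfIdele.comp continuous_fst).prodMk (continuous_kinfOfMaximalCompact.comp continuous_snd))
  have hboxm : MeasurableSet (box ×ˢ (Set.univ : Set ↥(maximalCompactAdelic n K))) :=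
    (measurableSet_unitBox _).prod MeasurableSet.univ
  have hIeq : Set.EqOn I (fun p => Fq (c p) * Γ' p) (box ×ˢ (Set.univ : Set ↥(maximalCompactAdelic n K))) := by
    rintro p ⟨hp, -⟩
    change I p = Fq (c p) * Γ' p
    rw [hI p hp, hFc ℂ F hF p hp]
  have hF1' : Fq 1 ≠ 0 := by
    have h : F (1 * r 1) = F 1 := hF 1 (glFiniteIntegralLevel n K).one_mem (r 1) h1
    rw [one_mul] at h
    change F (r 1) ≠ 0
    rw [h]
    exact hF1
  exact Literature.MeasureTheory.Group.integrableOn_of_integrableOn_fiberConst_mul νA νK hcmeas ρ hcρ box Fq hF1'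
    hΓ'c.aestronglyMeasurable hΓρ (hint.congr_fun hIeq hboxm)

/-- **Integrability for the image measures is integrability of the pull-back on the unit box** (the
`Integrable` companion of `setIntegral_unitBox_univ_prod_eq_integral_map`, `ArchRankinSelbergPairBridge`).
[folklore] -/
theorem integrable_map_prod_map_iff_integrableOn_unitBox (νA : Measure (Fin n → ideleGroup K)) [SFinite νA]
    (νK : Measure ↥(maximalCompactAdelic n K)) [SFinite νK]
    {F : (Fin n → (mixedSpace K)ˣ) × ↥(Kinf n K) → ℂ} (hF : Continuous F) :
    Integrable F (((νA.restrict (unitBox (Set.univ : Set (HeightOneSpectrum (𝓞 K))))).map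
        (archTorusOfIdele n K)).prod (νK.map (kinfOfMaximalCompact n K))) ↔
      IntegrableOn (fun p : (Fin n → ideleGroup K) × ↥(maximalCompactAdelic n K) =>
          F (archTorusOfIdele n K p.1, kinfOfMaximalCompact n K p.2))
        (unitBox (Set.univ : Set (HeightOneSpectrum (𝓞 K))) ×ˢ Set.univ) (νA.prod νK) := by
  have hΘm : Measurable (archTorusOfIdele n K) := continuous_archTorusOfIdele.measurable
  have hπm : Measurable (kinfOfMaximalCompact n K) := continuous_kinfOfMaximalCompact.measurable
  rw [Measure.map_prod_map _ _ hΘm hπm, integrable_map_measure hF.aestronglyMeasurable ((hΘm.prodMap hπm).aemeasurable)]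
  have hrestrict : (νA.restrict (unitBox (Set.univ : Set (HeightOneSpectrum (𝓞 K))))).prod νK =
      (νA.prod νK).restrict (unitBox (Set.univ : Set (HeightOneSpectrum (𝓞 K))) ×ˢ Set.univ) := by
    conv_lhs => rw [← Measure.restrict_univ (μ := νK)]
    rw [Measure.prod_restrict]
  rw [hrestrict]
  rfl

end Averaging

end Literature.NumberTheory.Automorphic
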